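import Summits.HodgeConjecture.HodgeConjecture.Theorems.K2LiuResiduePairingExchange
import Mathlib.Analysis.Calculus.ParametricIntegral
import Mathlib.Analysis.Complex.Schwarz
import Mathlib.Analysis.Calculus.Deriv.Slope
import Mathlib.Analysis.SpecificLimits.Basic
import HarnessLib

/-!
# The continued doubling pairing is holomorphic (socket #43a)

Track B ∕ hLiu418 = stmt-HodgeConjecture-24832, line `K2_Liu_CurveThetaSigs`, unit U6 «FIRST TERM AT THE TOP POLE» (the s5 seam), organ (F3a);
socket #43a `sig_K2LiuContinuedPairingHolomorphic` of `Cruxes/HLiu418/Lines/K2_Liu_CurveThetaSigs_U6_FirstTerm.lean` (ED. 1, :126) PAID BY NAME by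
`continuedPairingHolomorphic` below (statement byte-identical). Seat `hodgecm-mathlib-K2Liu-p03` (g2).

For ANY adelic group datum `𝒢`, a finite measure `μ` on `[G]`, `φ₁, φ₂ ∈ L²(μ)`, an open `O ⊆ ℂ` and a family `F : ℂ → [G]² → ℂ` with each `F s`
(`s ∈ O`) a.e.-strongly measurable, each `s ↦ F s x` holomorphic on `O`, and `F` locally uniformly bounded, the doubling pairing
★ `doublingPairing μ (F s) φ₁ φ₂ = ∫ F s x · φ₁ x.1 · conj (φ₂ x.2) d(μ ⊗ μ)` is holomorphic on `O`. Proof: differentiation under the Bochner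
integral (Mathlib `hasDerivAt_integral_of_dominated_loc_of_deriv_le`) at each `z ∈ O` on a disc `ball z δ` with `ball z 2δ ⊆ O ∩ {|F| ≤ C}`:
the derivative `∂_s F(s, x)` is bounded by `2C/δ` on `ball z δ` (Cauchy's estimate, Mathlib `Complex.norm_deriv_le_div_of_mapsTo_ball` on
`ball s δ`), the domination is `(2C/δ)·|φ₁(x₁)||φ₂(x₂)| ∈ L¹(μ ⊗ μ)` (★ `integrable_const_mul_norm_mul_norm`), and the derivative slice
`x ↦ ∂_s F(z, x)` is a.e.-strongly measurable as the everywhere limit of the measurable difference quotients along `z + δ/(2(n+1))`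
(`aestronglyMeasurable_of_tendsto_ae`, `hasDerivAt_iff_tendsto_slope`). [MoeglinWaldspurger1995, IV.1.9]; [Liu2021, Lem. B.12].

* `norm_deriv_le_of_bound` — Cauchy's estimate in the form used: `|F| ≤ C` on `ball z r`, `F` holomorphic there, `2δ ≤ r` ⇒ `‖∂F(s)‖ ≤ 2·max C 0/δ` on `ball z δ`.
* `aestronglyMeasurable_deriv_slice` — measurability of `x ↦ ∂_s F(z, x)`.
* `continuedPairingHolomorphic` — socket #43a.

No definition, no instance, no named fact; axioms ⊆ {propext, Classical.choice, Quot.sound}.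

## References
* C. Moeglin, J.-L. Waldspurger, *Spectral decomposition and Eisenstein series* (1995), IV.1.9 [MoeglinWaldspurger1995].
* Y. Liu, *Fourier–Jacobi cycles and arithmetic relative trace formula*, Camb. J. Math. 9 (2021), Lem. B.12 pp. 103–104 [Liu2021].

HONEST LABEL: HC_CM is proved only modulo the 7 printed citations (2 remaining named inputs: hLiu418 =
stmt-HodgeConjecture-24832, h413 = stmt-HodgeConjecture-24833) until rung 0 closes; #43a is a socket of the s5 seam — moves no counter.
-/

noncomputable section

set_option autoImplicit false

set_option linter.dupNamespace false

open scoped Matrix Topology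
open NumberField IsDedekindDomain MeasureTheory Filter Metric

namespace Summit.HodgeConjecture.HodgeConjecture.Cruxes.HLiu418.K2LiuContinuedPairingHolomorphic

open Literature.NumberTheory.Automorphic Literature.NumberTheory.GaloisRepresentations
open Literature.NumberTheory.GelbartRogawski1991 Literature.NumberTheory.GelbartRogawski1991.GRConstruction
open Literature.NumberTheory.K2Lit.SiegelDoubled
open Summit.HodgeConjecture.HodgeConjecture.Cruxes.HLiu418.K2LiuResiduePairingExchange

/-! ## §1 Cauchy's estimate on an inner disc -/

/-- **Cauchy's estimate, inner-disc form.** If `f` is holomorphic on `ball z r` with `‖f‖ ≤ C` there and `0 < δ`, `2δ ≤ r`, then for every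
`s ∈ ball z δ`, `‖deriv f s‖ ≤ 2 · max C 0 / δ` (apply Mathlib `Complex.norm_deriv_le_div_of_mapsTo_ball` on `ball s δ ⊆ ball z r`, which `f` maps
into `closedBall (f s) (2 max C 0)`). [cite: MoeglinWaldspurger1995, IV.1.9] -/
theorem norm_deriv_le_of_bound {f : ℂ → ℂ} {z : ℂ} {r δ C : ℝ} (hδ : 0 < δ) (hδr : 2 * δ ≤ r)
    (hd : DifferentiableOn ℂ f (ball z r)) (hC : ∀ w ∈ ball z r, ‖f w‖ ≤ C) {s : ℂ} (hs : s ∈ ball z δ) :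
    ‖deriv f s‖ ≤ 2 * max C 0 / δ := by
  have hsub : ball s δ ⊆ ball z r := by
    intro w hw
    rw [mem_ball] at hw hs ⊢
    calc dist w z ≤ dist w s + dist s z := dist_triangle _ _ _
      _ < δ + δ := add_lt_add hw hs
      _ = 2 * δ := by ring
      _ ≤ r := hδr
  have hmaps : Set.MapsTo f (ball s δ) (closedBall (f s) (2 * max C 0)) := by
    intro w hw
    rw [mem_closedBall, dist_eq_norm]
    calc ‖f w - f s‖ ≤ ‖f w‖ + ‖f s‖ := norm_sub_le _ _
      _ ≤ max C 0 + max C 0 := add_le_add ((hC w (hsub hw)).trans (le_max_left _ _))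
          ((hC s (hsub (mem_ball_self hδ))).trans (le_max_left _ _))
      _ = 2 * max C 0 := by ring
  exact Complex.norm_deriv_le_div_of_mapsTo_ball (hd.mono hsub) hmaps hδ

/-! ## §2 Measurability of the derivative slice -/

/-- **The derivative slice is a.e.-strongly measurable.** If `z ∈ O` (open), each `F s` (`s ∈ O`) is a.e.-strongly measurable and each
`s ↦ F s x` is differentiable on `O`, then `x ↦ deriv (F · x) z` is a.e.-strongly measurable: it is the everywhere limit of the difference
quotients `(F (z + tₙ) x − F z x)/tₙ` along `tₙ = (δ/2)/(n+1) → 0` with `z + tₙ ∈ O`. [folklore] -/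
theorem aestronglyMeasurable_deriv_slice {X : Type*} [MeasurableSpace X] (ν : Measure X)
    {O : Set ℂ} (hO : IsOpen O) {z : ℂ} (hz : z ∈ O) {F : ℂ → X → ℂ}
    (hmeas : ∀ s ∈ O, AEStronglyMeasurable (F s) ν) (hdiff : ∀ x, DifferentiableOn ℂ (fun s => F s x) O) :
    AEStronglyMeasurable (fun x => deriv (fun s => F s x) z) ν := by
  obtain ⟨ρ, hρ, hball⟩ := Metric.isOpen_iff.1 hO z hz
  -- the sequence `u n = z + (ρ/2)/(n+1)`
  set u : ℕ → ℂ := fun n => z + ((ρ / 2 : ℝ) : ℂ) * (1 / ((n : ℂ) + 1)) with hu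
  have ht : Tendsto (fun n : ℕ => ((ρ / 2 : ℝ) : ℂ) * (1 / ((n : ℂ) + 1))) atTop (𝓝 0) := by
    simpa using (tendsto_one_div_add_atTop_nhds_zero_nat (𝕜 := ℂ)).const_mul (((ρ / 2 : ℝ) : ℂ))
  have hnorm : ∀ n : ℕ, dist (u n) z = (ρ / 2) * (1 / ((n : ℝ) + 1)) := by
    intro n
    rw [hu, dist_eq_norm, add_sub_cancel_left, norm_mul, Complex.norm_real, Real.norm_of_nonneg (by positivity),
      show ((n : ℂ) + 1) = ((n + 1 : ℕ) : ℂ) by push_cast; ring, norm_div, norm_one, Complex.norm_natCast]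
    push_cast
    ring
  have hne : ∀ n, u n ≠ z := by
    intro n h
    have h0 : dist (u n) z = 0 := by rw [h, dist_self]
    rw [hnorm n] at h0
    have : (0 : ℝ) < (ρ / 2) * (1 / ((n : ℝ) + 1)) := by positivity
    exact this.ne' h0
  have hmem : ∀ n, u n ∈ O := by
    intro n
    refine hball ?_
    rw [mem_ball, hnorm n]
    have h1 : 1 / ((n : ℝ) + 1) ≤ 1 := by
      rw [div_le_one (by positivity)]
      linarith [(Nat.cast_nonneg n : (0 : ℝ) ≤ n)]
    calc ρ / 2 * (1 / ((n : ℝ) + 1)) ≤ ρ / 2 * 1 := by gcongr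
      _ < ρ := by linarith
  have hutend : Tendsto u atTop (𝓝[≠] z) := by
    refine tendsto_nhdsWithin_iff.2 ⟨?_, Eventually.of_forall fun n => hne n⟩
    simpa [hu] using (tendsto_const_nhds (x := z)).add ht
  -- the difference quotients and their limit
  refine aestronglyMeasurable_of_tendsto_ae atTop (f := fun n x => slope (fun s => F s x) z (u n)) ?_ ?_
  · intro n
    have h : (fun x => slope (fun s => F s x) z (u n)) = fun x => (u n - z)⁻¹ • (F (u n) x - F z x) := by
      funext x; rfl
    rw [h]
    exact ((hmeas (u n) (hmem n)).sub (hmeas z hz)).const_smul ((u n - z)⁻¹)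
  · refine Eventually.of_forall fun x => ?_
    have hd : HasDerivAt (fun s => F s x) (deriv (fun s => F s x) z) z :=
      ((hdiff x).differentiableAt (hO.mem_nhds hz)).hasDerivAt
    exact (hasDerivAt_iff_tendsto_slope.1 hd).comp hutend

/-! ## §3 Socket #43a -/

/-- **Socket #43a `sig_K2LiuContinuedPairingHolomorphic` — HOLOMORPHY OF A PARAMETRIC DOUBLING PAIRING** (statement byte-identical to
`Cruxes/HLiu418/Lines/K2_Liu_CurveThetaSigs_U6_FirstTerm.lean` ED. 1 :126). Differentiation under the integral sign at every `z ∈ O` (Mathlib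
`hasDerivAt_integral_of_dominated_loc_of_deriv_le` on `ball z δ`, `ball z (2δ) ⊆ O ∩ {|F| ≤ C}`) with the derivative bound `2 max C 0/δ` of §1, the
domination `(2 max C 0/δ)·|φ₁(x₁)||φ₂(x₂)|` (★ `integrable_const_mul_norm_mul_norm`) and the measurable derivative slice of §2.
[cite: MoeglinWaldspurger1995, IV.1.9] [cite: Liu2021, Lem. B.12 pp. 103–104] -/
theorem continuedPairingHolomorphic :
    ∀ (K : Type) [Field K] [NumberField K] (𝒢 : AdelicGroupData.{0} K)
      (μ : Measure 𝒢.automorphicQuotient) [IsFiniteMeasure μ]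
      (φ₁ φ₂ : 𝒢.automorphicQuotient → ℂ), MemLp φ₁ 2 μ → MemLp φ₂ 2 μ →
      ∀ (O : Set ℂ), IsOpen O →
      ∀ (F : ℂ → 𝒢.automorphicQuotient × 𝒢.automorphicQuotient → ℂ),
        (∀ s ∈ O, AEStronglyMeasurable (F s) (μ.prod μ)) →
        (∀ x, DifferentiableOn ℂ (fun s => F s x) O) →
        (∀ z ∈ O, ∃ C r : ℝ, 0 < r ∧ ∀ s : ℂ, dist s z < r → ∀ x, ‖F s x‖ ≤ C) →
        DifferentiableOn ℂ (fun s => doublingPairing 𝒢 μ (F s) φ₁ φ₂) O := by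
  intro K _ _ 𝒢 μ _ φ₁ φ₂ hφ₁ hφ₂ O hO F hmeas hdiff hbd z hz
  -- the disc
  obtain ⟨C, r, hr, hC⟩ := hbd z hz
  obtain ⟨ρ, hρ, hball⟩ := Metric.isOpen_iff.1 hO z hz
  set δ : ℝ := min r ρ / 2 with hδdef
  have hδ : 0 < δ := by rw [hδdef]; positivity
  have h2δr : 2 * δ ≤ r := by rw [hδdef]; linarith [min_le_left r ρ]
  have h2δρ : 2 * δ ≤ ρ := by rw [hδdef]; linarith [min_le_right r ρ]
  have hballO : ball z (2 * δ) ⊆ O := fun w hw => hball (ball_subset_ball h2δρ hw)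
  -- the two fixed factors
  have hφ₁m : AEStronglyMeasurable (fun x : 𝒢.automorphicQuotient × 𝒢.automorphicQuotient => φ₁ x.1) (μ.prod μ) :=
    hφ₁.aestronglyMeasurable.comp_fst
  have hφ₂m : AEStronglyMeasurable
      (fun x : 𝒢.automorphicQuotient × 𝒢.automorphicQuotient => starRingEnd ℂ (φ₂ x.2)) (μ.prod μ) :=
    Complex.continuous_conj.comp_aestronglyMeasurable hφ₂.aestronglyMeasurable.comp_snd
  -- the derivative bound on `ball z δ`
  set D : ℝ := 2 * max C 0 / δ with hDdef
  have hD0 : 0 ≤ D := by rw [hDdef]; positivity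
  have hderiv : ∀ x, ∀ s ∈ ball z δ, ‖deriv (fun t => F t x) s‖ ≤ D := by
    intro x s hs
    exact norm_deriv_le_of_bound hδ le_rfl ((hdiff x).mono hballO)
      (fun w hw => hC w (lt_of_lt_of_le (mem_ball.1 hw) h2δr) x) hs
  -- differentiation under the integral sign at `z`
  have key := hasDerivAt_integral_of_dominated_loc_of_deriv_le (μ := μ.prod μ)
    (F := fun s x => F s x * φ₁ x.1 * starRingEnd ℂ (φ₂ x.2))
    (F' := fun s x => deriv (fun t => F t x) s * φ₁ x.1 * starRingEnd ℂ (φ₂ x.2))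
    (x₀ := z) (s := ball z δ) (bound := fun x => D * (‖φ₁ x.1‖ * ‖φ₂ x.2‖))
    (ball_mem_nhds z hδ) ?_ ?_ ?_ ?_ (integrable_const_mul_norm_mul_norm 𝒢 μ hφ₁ hφ₂ D) ?_
  · exact key.2.differentiableAt.differentiableWithinAt
  · -- measurability of `F s · φ₁ · conj φ₂` near `z`
    filter_upwards [hO.mem_nhds hz] with s hs
    exact ((hmeas s hs).mul hφ₁m).mul hφ₂m
  · -- integrability at `z`
    refine Integrable.mono' (integrable_const_mul_norm_mul_norm 𝒢 μ hφ₁ hφ₂ (max C 0))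
      (((hmeas z hz).mul hφ₁m).mul hφ₂m) (Eventually.of_forall fun x => ?_)
    rw [norm_mul, norm_mul, Complex.norm_conj, mul_assoc]
    exact mul_le_mul_of_nonneg_right ((hC z (by rw [dist_self]; exact hr) x).trans (le_max_left _ _))
      (mul_nonneg (norm_nonneg _) (norm_nonneg _))
  · -- measurability of the derivative slice at `z`
    exact ((aestronglyMeasurable_deriv_slice (μ.prod μ) hO hz hmeas hdiff).mul hφ₁m).mul hφ₂m
  · -- the derivative bound
    refine Eventually.of_forall fun x s hs => ?_
    rw [norm_mul, norm_mul, Complex.norm_conj, mul_assoc]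
    exact mul_le_mul_of_nonneg_right (hderiv x s hs) (mul_nonneg (norm_nonneg _) (norm_nonneg _))
  · -- pointwise derivatives on `ball z δ`
    refine Eventually.of_forall fun x s hs => ?_
    have hsO : s ∈ O := hballO (ball_subset_ball (by linarith) hs)
    have hd : HasDerivAt (fun t => F t x) (deriv (fun t => F t x) s) s :=
      ((hdiff x).differentiableAt (hO.mem_nhds hsO)).hasDerivAt
    exact (hd.mul_const (φ₁ x.1)).mul_const (starRingEnd ℂ (φ₂ x.2))

end Summit.HodgeConjecture.HodgeConjecture.Cruxes.HLiu418.K2LiuContinuedPairingHolomorphic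

end
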